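import Literature.AnabelianGeometry.EtaleTheta.Discharge.Sec4BiKummerRoots
import Literature.AnabelianGeometry.EtaleTheta.Discharge.Sec4Model
import Literature.AnabelianGeometry.EtaleTheta.BiKummerKummerClass

/-!
# [EtTh] Prop 4.3 (iii), SECOND CLAUSE: the bi-Kummer difference IS the Kummer cocycle of `f|_{B_N}` — PROVED
# (dictionary form over any §4 setting; outright at the model instances `mkOfModel`; `H¹` form)

S. Mochizuki, *The étale theta function and its Frobenioid-theoretic manifestations*, Publ. RIMS **45**
(2009) [MochizukiEtTh2009], Prop 4.3 (iii) PDF p.91 (printed 317): "the difference `s'_N{}^{gp} · (s''_N{}^{gp})⁻¹`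
determines a twisted homomorphism `H_{B_N} → μ_N(B_N)`, hence an element of the cohomology module
`H¹(H_{B_N}, μ_N(B_N))`, which is equal to the Kummer class [cf. [Mzk18], Definition 2.1, (ii)] `κ_{f|_{B_N}}` … of
`f|_{B_N}` ….  In particular, this cohomology class is independent of the [simultaneous and non-simultaneous]
conjugation operations discussed in (ii)."  Proof (p.91): "follows immediately from the definitions".
The statement of record `BiKummerSetting.Prop43_iii` (`BiKummerRoots.lean`, owner abc-iut-L2-t3) renders the FIRST
clause (values in `μ_N(B_N)`; discharged by abc-iut-L6-t12, `Discharge/Sec4BiKummerRoots` / `Sec4Model`) and deferred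
the comparison with the [FrdII] Def 2.1 (ii) Kummer class — now in the tree for the §4 setting
(`BiKummerKummerClass.lean`, `BiKummerSetting.kummerClassOfRoot`).  This file proves the second clause (two auxiliary
`def`s, `diffUnit` / `diffCocycle` = print's "twisted homomorphism"; everything else theorems):
* `BiKummerRoot.toB_biratAut_restrict` — DICTIONARY FORM over any §4 setting `S` (hypotheses = L6-t12's for clause 1:
  `B` group-like and the [FrdI] Thm 5.2 (ii) dictionary `toB : O^×(A^birat) ↪ B(A_D)^×` computing fractions, the
  `Aut_C`-action and restriction along pre-steps): for `h ∈ H_{B_N}` and the `N`-th root `g := f_N|_{B_N}` of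
  `f|_{B_N}`, **`toB(h·g) = u_{s''(h)·s'(h)⁻¹} · toB(g)`** — the Kummer cocycle `h ↦ (h·g)·g⁻¹` of `g` ([FrdII] Def
  2.1 (ii), tree convention `h·g = ζ_h·g`, `Frobenioids.Kummer.smul_root_eq`) IS the rational function of the bi-Kummer
  difference; from L6-t12's identity at `A_N` (`pull_unit_sNum_mul_root`) transported along the base-isomorphism
  `Base(s'_N)` via the pin `autBase_ident`;
* `BiKummerRoot.biratAut_restrict_mkOfModel` — OUTRIGHT at abc-iut-L2-t9's `mkOfModel` (dictionary = identity),
  `u_{w(h)}` = `diffUnit h`, the image of `w(h) = s''(h)·s'(h)⁻¹ ∈ O^×(B_N)` under the model's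
  `O^×(B_N) ↪ O^×(B_N^birat)`, `α ↦ u_α` (L1 `ModelFrobenioid.unitsToRatFn`, [FrdI] Thm 5.2 (ii)); `diffUnit_pow_eq_one`;
* at Hom- and monoid-universe `0` (Mathlib `groupCohomology`, cf. `BiKummerKummerClass.lean` note 3): `diffCocycle`,
  `kummerCocycle_restrict_eq_diffCocycle`, `isMulCocycle₁_diffCocycle`, **`kummerClassOfRoot_restrict_eq`** (`κ_{f|_{B_N}}`
  = the class of `diffCocycle`: the SECOND CLAUSE) and `diffClass_eq_of_biKummerRoot` ("In particular": any two
  bi-Kummer roots of the same `N`-th root give the same class, both being `κ_{f|_{B_N}}`).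
SIGN CONVENTION (honest): print writes `s'·(s'')⁻¹`; [FrdII] Def 2.1 (ii) fixes no sign for the Kummer cocycle (it
names the class of the `μ_N(A)`-torsor of roots).  With the tree's conventions `h·g = ζ_h·g` (L1) and `σ·x =
B(Base σ⁻¹)(x)` (= conjugation `σxσ⁻¹`, [FrdII] Def 2.1 (i)) the kernel gives `ζ_h = u_{s''(h)·s'(h)⁻¹}`; the class of
`h ↦ s'(h)·s''(h)⁻¹` is `−κ_{f|_{B_N}}`, the same datum.  `μ_N` is read in `O^×(B_N^birat)` (note 2 of
`BiKummerKummerClass.lean`); at the model the comparison map is explicit (`unitsToRatFn`).  HONEST FRAMING: refereed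
pre-IUT material; inputs = `Φ` divisorial / `B` group-like (as for clause 1); nothing bears on [IUTchIII] Cor. 3.12.
-/

noncomputable section

namespace Literature.AnabelianGeometry.EtaleTheta

open CategoryTheory Opposite Literature.AlgebraicGeometry.Frobenioids groupCohomology
open Literature.AlgebraicGeometry.Frobenioids.PreFrobenioid (pull_inv_pull_eq pull_pull_inv_eq pull_injective)

universe u₀ v₀ u v w

variable {Kf : Type u₀} [Field Kf]

namespace BiKummerSetting

namespace BiKummerRoot

section Dictionary

variable {X : SemiGraphs.TemperedArithmeticGroup.{u₀} Kf} {D₀ : Type u₀} [Category.{v₀} D₀]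
  {V : FrdIMonoidStub.{w}} {T : RealifiedDivisorMonoids (D₀ := D₀) V} {D : Type u} [Category.{v} D]
  {VD : FrdICatStub.{u, v, w} D} {S : BiKummerSetting X T D VD}
  {A B : S.C} {f : S.biratUnits A} {P : S.FractionPair f B} {N : ℕ+}
  {pullFrac : ∀ {A A' : S.C} (_ : A' ⟶ A), S.biratUnits A → S.biratUnits A'}
  {R : S.NthRoot f P N pullFrac} {hA : S.IsGalois R.AN} {hB : S.IsGalois R.BN}
  (K : S.BiKummerRoot R hA hB)

/-- `Base(s'^{gp}(h)) = Base(h)`: the section `s'^{gp}` LIFTS `h ∈ H_{B_N}` (from `comm_num`, the pin `autBase_ident`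
and the section property `autBase_striv`, cancelling `Base(s'_N)`). [cite: MochizukiEtTh2009, Prop 4.3(i) p.90] -/
theorem baseMap_sNum_eq (h : S.HA R.BN hB) :
    ModelFrobenioid.baseMap (K.sNum h).hom = ModelFrobenioid.baseMap (h : Aut R.BN).hom := by
  haveI : IsIso (ModelFrobenioid.baseMap R.pair.num) := R.pair.isPreStep_num.2
  have e1 := congrArg ModelFrobenioid.baseMap (K.comm_num' h)
  rw [ModelFrobenioid.baseMap_comp, ModelFrobenioid.baseMap_comp] at e1
  have e2 : ModelFrobenioid.baseMap (K.striv (K.ident.symm h)).hom =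
      ModelFrobenioid.baseMap ((K.ident.symm h : S.HA R.AN hA) : Aut R.AN).hom :=
    congrArg Iso.hom (K.autBase_striv (K.ident.symm h))
  have e3 := K.autBase_ident (K.ident.symm h)
  rw [MulEquiv.apply_symm_apply] at e3
  change ModelFrobenioid.baseMap R.pair.num ≫ ModelFrobenioid.baseMap (h : Aut R.BN).hom =
    ModelFrobenioid.baseMap ((K.ident.symm h : S.HA R.AN hA) : Aut R.AN).hom ≫ ModelFrobenioid.baseMap R.pair.num
    at e3
  rw [e2, ← e3] at e1
  exact (cancel_epi _).1 e1

/-- `Base(s'^{gp}(h)⁻¹) = Base(h⁻¹)`. [cite: MochizukiEtTh2009, Prop 4.3(i) p.90] -/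
theorem baseMap_sNum_inv_eq (h : S.HA R.BN hB) :
    ModelFrobenioid.baseMap (K.sNum h).inv = ModelFrobenioid.baseMap (h : Aut R.BN).inv := by
  have e1 : ModelFrobenioid.baseMap (h : Aut R.BN).hom ≫ ModelFrobenioid.baseMap (h : Aut R.BN).inv = 𝟙 _ := by
    rw [← ModelFrobenioid.baseMap_comp, Iso.hom_inv_id, ModelFrobenioid.baseMap_id]
  calc ModelFrobenioid.baseMap (K.sNum h).inv
      = ModelFrobenioid.baseMap (K.sNum h).inv ≫
          (ModelFrobenioid.baseMap (h : Aut R.BN).hom ≫ ModelFrobenioid.baseMap (h : Aut R.BN).inv) := by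
        rw [e1, Category.comp_id]
    _ = (ModelFrobenioid.baseMap (K.sNum h).inv ≫ ModelFrobenioid.baseMap (K.sNum h).hom) ≫
          ModelFrobenioid.baseMap (h : Aut R.BN).inv := by rw [K.baseMap_sNum_eq h, Category.assoc]
    _ = ModelFrobenioid.baseMap (h : Aut R.BN).inv := by
        rw [ModelFrobenioid.baseMap_inv_hom, Category.id_comp]

/-- `Base(s'_N) ≫ Base(h⁻¹) = Base(τ⁻¹) ≫ Base(s'_N)` (diagrammatic) for `τ = s^triv(ident⁻¹ h)`: the pin
`autBase_ident` with the section property of `s^triv`, inverted. [cite: MochizukiEtTh2009, Prop 4.3(i) p.90] -/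
theorem baseMap_num_comp_baseMap_inv (h : S.HA R.BN hB) :
    ModelFrobenioid.baseMap R.pair.num ≫ ModelFrobenioid.baseMap (h : Aut R.BN).inv =
      ModelFrobenioid.baseMap (K.striv (K.ident.symm h)).inv ≫ ModelFrobenioid.baseMap R.pair.num := by
  have e2 : ModelFrobenioid.baseMap (K.striv (K.ident.symm h)).hom =
      ModelFrobenioid.baseMap ((K.ident.symm h : S.HA R.AN hA) : Aut R.AN).hom :=
    congrArg Iso.hom (K.autBase_striv (K.ident.symm h))
  have e3 := K.autBase_ident (K.ident.symm h)
  rw [MulEquiv.apply_symm_apply] at e3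
  change ModelFrobenioid.baseMap R.pair.num ≫ ModelFrobenioid.baseMap (h : Aut R.BN).hom =
    ModelFrobenioid.baseMap ((K.ident.symm h : S.HA R.AN hA) : Aut R.AN).hom ≫ ModelFrobenioid.baseMap R.pair.num
    at e3
  rw [← e2] at e3
  -- e3 : b ≫ Base h = Base τ ≫ b
  have hτi : ModelFrobenioid.baseMap (K.striv (K.ident.symm h)).inv ≫
      ModelFrobenioid.baseMap (K.striv (K.ident.symm h)).hom = 𝟙 _ :=
    ModelFrobenioid.baseMap_inv_hom _ _
  have hhi : ModelFrobenioid.baseMap (h : Aut R.BN).hom ≫ ModelFrobenioid.baseMap (h : Aut R.BN).inv = 𝟙 _ := by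
    rw [← ModelFrobenioid.baseMap_comp, Iso.hom_inv_id, ModelFrobenioid.baseMap_id]
  calc ModelFrobenioid.baseMap R.pair.num ≫ ModelFrobenioid.baseMap (h : Aut R.BN).inv
      = (ModelFrobenioid.baseMap (K.striv (K.ident.symm h)).inv ≫
          ModelFrobenioid.baseMap (K.striv (K.ident.symm h)).hom) ≫
          ModelFrobenioid.baseMap R.pair.num ≫ ModelFrobenioid.baseMap (h : Aut R.BN).inv := by
        rw [hτi, Category.id_comp]
    _ = ModelFrobenioid.baseMap (K.striv (K.ident.symm h)).inv ≫
          (ModelFrobenioid.baseMap (K.striv (K.ident.symm h)).hom ≫ ModelFrobenioid.baseMap R.pair.num) ≫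
          ModelFrobenioid.baseMap (h : Aut R.BN).inv := by simp only [Category.assoc]
    _ = ModelFrobenioid.baseMap (K.striv (K.ident.symm h)).inv ≫
          (ModelFrobenioid.baseMap R.pair.num ≫ ModelFrobenioid.baseMap (h : Aut R.BN).hom) ≫
          ModelFrobenioid.baseMap (h : Aut R.BN).inv := by rw [e3]
    _ = ModelFrobenioid.baseMap (K.striv (K.ident.symm h)).inv ≫ ModelFrobenioid.baseMap R.pair.num := by
        rw [Category.assoc, hhi, Category.comp_id]

/-- **The rational function of `w(h) := s''^{gp}(h) · s'^{gp}(h)⁻¹ ∈ O^×(B_N)`**: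
`u_{w(h)} · Base(h⁻¹)^* u_{s'(h)} = Base(h⁻¹)^* u_{s''(h)}` in `B(B_N)` ([FrdI] Thm 5.2 (i) composition law).
[cite: MochizukiEtTh2009, Prop 4.3(iii) p.91] -/
theorem unit_sDen_mul_sNum_inv (h : S.HA R.BN hB) :
    ModelFrobenioid.unit (K.sDen h * (K.sNum h)⁻¹ : Aut R.BN).hom *
        pull S.tf.ratFnFunctor (ModelFrobenioid.baseMap (h : Aut R.BN).inv) (ModelFrobenioid.unit (K.sNum h).hom) =
      pull S.tf.ratFnFunctor (ModelFrobenioid.baseMap (h : Aut R.BN).inv) (ModelFrobenioid.unit (K.sDen h).hom) := by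
  have e0 := congrArg ModelFrobenioid.unit (K.sNum h).inv_hom_id
  rw [ModelFrobenioid.unit_comp_of_degFr_eq_one _ (ModelFrobenioid.degFr_eq_one_of_isIso _),
    ModelFrobenioid.unit_id, K.baseMap_sNum_inv_eq h] at e0
  change ModelFrobenioid.unit ((K.sNum h).inv ≫ (K.sDen h).hom) * _ = _
  rw [ModelFrobenioid.unit_comp_of_degFr_eq_one _ (ModelFrobenioid.degFr_eq_one_of_isIso _),
    K.baseMap_sNum_inv_eq h, mul_assoc, mul_comm (ModelFrobenioid.unit (K.sNum h).inv), e0, mul_one]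

/-- **Prop 4.3 (iii), the Kummer cocycle at `B_N` (dictionary form).**  For `h ∈ H_{B_N}` and the `N`-th root
`g := f_N|_{B_N}` of `f|_{B_N}`: `toB(h · g) = u_{s''(h)·s'(h)⁻¹} · toB(g)` in `B(B_N)` — the Kummer cocycle of `g` is
the rational function of the bi-Kummer difference (hypotheses: L6-t12's [FrdI] Thm 5.2 (ii) dictionary for clause 1
plus its restriction clause `hres` "`Base(s)^*(f|_B) = f`", `B` group-like). [cite: MochizukiEtTh2009, Prop 4.3(iii) p.91] -/
theorem toB_biratAut_restrict
    (hBg : Objectwise (fun M _ => IsGroupLike M) S.tf.ratFnFunctor)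
    (toB : ∀ A : S.C, S.biratUnits A →* (S.tf.ratFnFunctor.obj (op A.base))ˣ)
    (hfrac : ∀ {A B : S.C} (s' s'' : A ⟶ B) (h' : S.IsPreStep s') (h'' : S.IsPreStep s'')
      (hb : PreFrobenioid.BaseEquivalent S.F s' s''),
      (toB A (S.fracOf s' s'' h' h'' hb) : S.tf.ratFnFunctor.obj (op A.base)) *
        ModelFrobenioid.unit s'' = ModelFrobenioid.unit s')
    (haut : ∀ {A : S.C} (σ : Aut A) (x : S.biratUnits A),
      (toB A (S.biratAut A σ x) : S.tf.ratFnFunctor.obj (op A.base)) =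
        pull S.tf.ratFnFunctor (ModelFrobenioid.baseMap σ.inv) (toB A x : S.tf.ratFnFunctor.obj (op A.base)))
    (hres : ∀ {A B : S.C} (s : A ⟶ B) (hs : S.IsPreStep s) (x : S.biratUnits A),
      pull S.tf.ratFnFunctor (ModelFrobenioid.baseMap s)
        (toB B (S.restrictAlong s hs x) : S.tf.ratFnFunctor.obj (op B.base)) =
        (toB A x : S.tf.ratFnFunctor.obj (op A.base)))
    (h : S.HA R.BN hB) :
    (toB R.BN (S.biratAut R.BN (h : Aut R.BN) R.pair.restrict) : S.tf.ratFnFunctor.obj (op R.BN.base)) =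
      ModelFrobenioid.unit (K.sDen h * (K.sNum h)⁻¹ : Aut R.BN).hom *
        (toB R.BN R.pair.restrict : S.tf.ratFnFunctor.obj (op R.BN.base)) := by
  haveI : IsCancelMul (S.tf.ratFnFunctor.obj (op R.AN.base)) :=
    isIntegral_iff_isCancelMul.mp (hBg R.AN.base).isPreDivisorial.isIntegral
  haveI : IsIso (ModelFrobenioid.baseMap R.pair.num) := R.pair.isPreStep_num.2
  -- (0) restriction is undone by pull-back: `b^* y = x`
  have hyx : pull S.tf.ratFnFunctor (ModelFrobenioid.baseMap R.pair.num)
      (toB R.BN R.pair.restrict : S.tf.ratFnFunctor.obj (op R.BN.base)) =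
      (toB R.AN R.root : S.tf.ratFnFunctor.obj (op R.AN.base)) := hres R.pair.num R.pair.isPreStep_num R.root
  -- (1) L6-t12's cocycle identity at `A_N`, (2) transported along `Base(τ⁻¹)`
  have E := K.pull_unit_sNum_mul_root hBg toB hfrac h
  have E' : pull S.tf.ratFnFunctor (ModelFrobenioid.baseMap (K.striv (K.ident.symm h)).inv)
        (pull S.tf.ratFnFunctor (ModelFrobenioid.baseMap R.pair.num) (ModelFrobenioid.unit (K.sNum h).hom)) *
      pull S.tf.ratFnFunctor (ModelFrobenioid.baseMap (K.striv (K.ident.symm h)).inv)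
        (toB R.AN R.root : S.tf.ratFnFunctor.obj (op R.AN.base)) =
      (toB R.AN R.root : S.tf.ratFnFunctor.obj (op R.AN.base)) *
      pull S.tf.ratFnFunctor (ModelFrobenioid.baseMap (K.striv (K.ident.symm h)).inv)
        (pull S.tf.ratFnFunctor (ModelFrobenioid.baseMap R.pair.num) (ModelFrobenioid.unit (K.sDen h).hom)) := by
    have e := congrArg (pull S.tf.ratFnFunctor (ModelFrobenioid.baseMap (K.striv (K.ident.symm h)).inv)) E
    rw [map_mul, map_mul, ← pull_comp S.tf.ratFnFunctor (ModelFrobenioid.baseMap (K.striv (K.ident.symm h)).inv)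
      (ModelFrobenioid.baseMap (K.striv (K.ident.symm h)).hom), ModelFrobenioid.baseMap_inv_hom, pull_id] at e
    exact e
  -- (3) the rational function of `w(h)` pulled back along `b`, then along `Base(τ⁻¹)`
  have W := congrArg (pull S.tf.ratFnFunctor (ModelFrobenioid.baseMap R.pair.num)) (K.unit_sDen_mul_sNum_inv h)
  rw [map_mul, ← pull_comp, ← pull_comp, K.baseMap_num_comp_baseMap_inv h, pull_comp, pull_comp] at W
  -- (4) pull the goal back along `b` (injective) and compute
  apply pull_injective (ModelFrobenioid.baseMap R.pair.num)
  rw [map_mul, hyx, haut, ← pull_comp, K.baseMap_num_comp_baseMap_inv h, pull_comp, hyx]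
  apply mul_right_cancel (b := pull S.tf.ratFnFunctor (ModelFrobenioid.baseMap (K.striv (K.ident.symm h)).inv)
    (pull S.tf.ratFnFunctor (ModelFrobenioid.baseMap R.pair.num) (ModelFrobenioid.unit (K.sNum h).hom)))
  rw [mul_comm, E', mul_right_comm, W, mul_comm]

end Dictionary

/-! ### Outright at the model instances `mkOfModel` (dictionary = identity) -/

section Model

variable (X : SemiGraphs.TemperedArithmeticGroup.{u₀} Kf) {D₀ : Type u₀} [Category.{v₀} D₀]
  {V : FrdIMonoidStub.{w}} {T : RealifiedDivisorMonoids (D₀ := D₀) V} {D : Type u} [Category.{v} D]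
  {VD : FrdICatStub.{u, v, w} D}
  (tf : TemperedFrobenioid T D VD) (hZ : tf.monoidType = MonoidType.Z)
  (hP : ∀ A : Dᵒᵖ, IsPerfect (tf.Φ.carrier A)) (hBΛ : ∀ (Y : D₀ᵒᵖ) (b : T.BΛ.obj Y), IsUnit b)
  (DS : ∀ {A : Dᵒᵖ}, tf.Φ.carrier A → tf.Φ.carrier A → Prop) (IG : D → Prop)
  (gS : ∀ A : D, IG A → (X.Pi →* Aut A)) (gSs : ∀ (A : D) (h : IG A), Function.Surjective (gS A h))
  (NH : Subgroup (Field.absoluteGaloisGroup Kf) → tf.category → ℕ+ → Prop)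
  (AB : ∀ {A B : tf.category}, Subgroup (Aut A) → (A ⟶ A) → (A ⟶ B) → Prop) (A₀ : tf.category)
  (hA₀ : PreFrobenioid.IsFrobeniusTrivial tf.toElem A₀) (hA₀' : IG A₀.base)
  {A B : tf.category} {f : tf.biratUnitsModel A}
  {P : (mkOfModel X tf hZ hP hBΛ DS IG gS gSs NH AB A₀ hA₀ hA₀').FractionPair f B} {N : ℕ+}
  {pullFrac : ∀ {A A' : tf.category} (_ : A' ⟶ A), tf.biratUnitsModel A → tf.biratUnitsModel A'}
  {R : (mkOfModel X tf hZ hP hBΛ DS IG gS gSs NH AB A₀ hA₀ hA₀').NthRoot f P N pullFrac}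
  {hA : (mkOfModel X tf hZ hP hBΛ DS IG gS gSs NH AB A₀ hA₀ hA₀').IsGalois R.AN}
  {hB : (mkOfModel X tf hZ hP hBΛ DS IG gS gSs NH AB A₀ hA₀ hA₀').IsGalois R.BN}
  (K : (mkOfModel X tf hZ hP hBΛ DS IG gS gSs NH AB A₀ hA₀ hA₀').BiKummerRoot R hA hB)

/-- The bi-Kummer difference `w(h) := s''^{gp}(h)·s'^{gp}(h)⁻¹` as an element of `O^×(B_N)` of the model Frobenioid
(base-identity, linear: abc-iut-L6-t12's `sNum_mul_sDen_inv_mem_units`, inverted). [cite: MochizukiEtTh2009, Prop 4.3(iii) p.91] -/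
theorem sDen_mul_sNum_inv_mem_units (h : (mkOfModel X tf hZ hP hBΛ DS IG gS gSs NH AB A₀ hA₀ hA₀').HA R.BN hB) :
    K.sDen h * (K.sNum h)⁻¹ ∈ ModelFrobenioid.units R.BN := by
  have e : K.sDen h * (K.sNum h)⁻¹ = (K.sNum h * (K.sDen h)⁻¹)⁻¹ := by rw [mul_inv_rev, inv_inv]
  rw [e]
  exact (ModelFrobenioid.units R.BN).inv_mem (K.sNum_mul_sDen_inv_mem_units h)

/-- **`u_{w(h)} ∈ O^×(B_N^birat)`**: the image of the bi-Kummer difference `w(h) = s''^{gp}(h)·s'^{gp}(h)⁻¹ ∈ O^×(B_N)`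
under the model's `O^×(B_N) ↪ O^×(B_N^birat) = B(B_N)^×`, `α ↦ u_α` (`ModelFrobenioid.unitsToRatFn`), as a birational
unit of the setting `mkOfModel`. [cite: MochizukiEtTh2009, Prop 4.3(iii) p.91] -/
def diffUnit (h : (mkOfModel X tf hZ hP hBΛ DS IG gS gSs NH AB A₀ hA₀ hA₀').HA R.BN hB) :
    (mkOfModel X tf hZ hP hBΛ DS IG gS gSs NH AB A₀ hA₀ hA₀').biratUnits R.BN :=
  ModelFrobenioid.unitsToRatFn R.BN
    ⟨K.sDen h * (K.sNum h)⁻¹, K.sDen_mul_sNum_inv_mem_units X tf hZ hP hBΛ DS IG gS gSs NH AB A₀ hA₀ hA₀' h⟩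

/-- `diffUnit h` is the rational function `u_{w(h)}`. [cite: MochizukiEtTh2009, Prop 4.3(iii) p.91] -/
theorem coe_diffUnit (h : (mkOfModel X tf hZ hP hBΛ DS IG gS gSs NH AB A₀ hA₀ hA₀').HA R.BN hB) :
    Units.val (K.diffUnit X tf hZ hP hBΛ DS IG gS gSs NH AB A₀ hA₀ hA₀' h) =
      ModelFrobenioid.unit (K.sDen h * (K.sNum h)⁻¹ : Aut R.BN).hom :=
  rfl

/-- **Prop 4.3 (iii), the Kummer cocycle at `B_N`, OUTRIGHT for the model instances `mkOfModel`**: for every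
`h ∈ H_{B_N}`, `h · g = u_{w(h)} · g` in `O^×(B_N^birat) = B(B_N)^×`, where `g = f_N|_{B_N}` is the `N`-th root of
`f|_{B_N}` and `w(h) = s''^{gp}(h)·s'^{gp}(h)⁻¹`. [cite: MochizukiEtTh2009, Prop 4.3(iii) p.91] -/
theorem biratAut_restrict_mkOfModel (h : (mkOfModel X tf hZ hP hBΛ DS IG gS gSs NH AB A₀ hA₀ hA₀').HA R.BN hB) :
    (mkOfModel X tf hZ hP hBΛ DS IG gS gSs NH AB A₀ hA₀ hA₀').biratAut R.BN (h : Aut R.BN) R.pair.restrict =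
      K.diffUnit X tf hZ hP hBΛ DS IG gS gSs NH AB A₀ hA₀ hA₀' h * R.pair.restrict := by
  apply Units.ext
  exact K.toB_biratAut_restrict (tf.isGroupLike_ratFnFunctor hBΛ) (fun A => MonoidHom.id (tf.biratUnitsModel A))
    (fun s' s'' _ _ _ => coe_fracOfModel_mul_unit tf hBΛ s' s'') (fun σ x => coe_biratAutModel_eq_pull tf σ x)
    (fun s hs x => pull_coe_restrictAlongModel tf s hs x) h

/-- `u_{w(h)}^N = 1` (clause 1, L6-t12's `sNum_mul_sDen_inv_pow_eq_one`, `Φ` divisorial). [cite: MochizukiEtTh2009, Prop 4.3(iii) p.91] -/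
theorem diffUnit_pow_eq_one (hΦd : Objectwise (fun M _ => IsDivisorial M) tf.divisorMonoid)
    (h : (mkOfModel X tf hZ hP hBΛ DS IG gS gSs NH AB A₀ hA₀ hA₀').HA R.BN hB) :
    K.diffUnit X tf hZ hP hBΛ DS IG gS gSs NH AB A₀ hA₀ hA₀' h ^ (N : ℕ) = 1 := by
  have e : K.sDen h * (K.sNum h)⁻¹ = (K.sNum h * (K.sDen h)⁻¹)⁻¹ := by rw [mul_inv_rev, inv_inv]
  have hw : (K.sDen h * (K.sNum h)⁻¹) ^ (N : ℕ) = 1 := by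
    rw [e, inv_pow, K.sNum_mul_sDen_inv_pow_eq_one hΦd (tf.isGroupLike_ratFnFunctor hBΛ)
      (fun A => MonoidHom.id (tf.biratUnitsModel A)) (fun s' s'' _ _ _ => coe_fracOfModel_mul_unit tf hBΛ s' s'')
      (fun σ x => coe_biratAutModel_eq_pull tf σ x) h, inv_one]
  have h1 : (⟨K.sDen h * (K.sNum h)⁻¹, K.sDen_mul_sNum_inv_mem_units X tf hZ hP hBΛ DS IG gS gSs NH AB A₀ hA₀ hA₀'
      h⟩ : ModelFrobenioid.units R.BN) ^ (N : ℕ) = 1 :=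
    Subtype.ext (by rw [SubmonoidClass.coe_pow, OneMemClass.coe_one]; exact hw)
  have h2 := congrArg (ModelFrobenioid.unitsToRatFn R.BN) h1
  rw [map_pow, map_one] at h2
  exact h2

/-- `f|_{B_N} := (f|_{A_N})|_{B_N} = g^N` is `H_{B_N}`-fixed at the model (`Φ` divisorial), granted a bi-Kummer root `K`:
`h · g^N = (u_{w(h)} · g)^N = g^N`. [cite: MochizukiEtTh2009, Prop 4.3(iii) p.91] -/
theorem isFixedByHA_restrict_pow_mkOfModel
    (K : (mkOfModel X tf hZ hP hBΛ DS IG gS gSs NH AB A₀ hA₀ hA₀').BiKummerRoot R hA hB)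
    (hΦd : Objectwise (fun M _ => IsDivisorial M) tf.divisorMonoid) :
    (mkOfModel X tf hZ hP hBΛ DS IG gS gSs NH AB A₀ hA₀ hA₀').IsFixedByHA R.BN hB (R.pair.restrict ^ (N : ℕ)) := by
  intro σ hσ
  rw [map_pow]
  change ((mkOfModel X tf hZ hP hBΛ DS IG gS gSs NH AB A₀ hA₀ hA₀').biratAut R.BN
    ((⟨σ, hσ⟩ : (mkOfModel X tf hZ hP hBΛ DS IG gS gSs NH AB A₀ hA₀ hA₀').HA R.BN hB) : Aut R.BN) R.pair.restrict) ^
      (N : ℕ) = _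
  rw [K.biratAut_restrict_mkOfModel, mul_pow, K.diffUnit_pow_eq_one X tf hZ hP hBΛ DS IG gS gSs NH AB A₀ hA₀ hA₀' hΦd,
    one_mul]

end Model

/-! ### The second clause in `H¹(H_{B_N}, μ_N)` (Hom- and monoid-universe `0`) -/

section KummerClass

variable (X : SemiGraphs.TemperedArithmeticGroup.{u₀} Kf) {D₀ : Type u₀} [Category.{v₀} D₀]
  {V : FrdIMonoidStub.{0}} {T : RealifiedDivisorMonoids (D₀ := D₀) V} {D : Type u} [Category.{0} D]
  {VD : FrdICatStub.{u, 0, 0} D}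
  (tf : TemperedFrobenioid T D VD) (hZ : tf.monoidType = MonoidType.Z)
  (hP : ∀ A : Dᵒᵖ, IsPerfect (tf.Φ.carrier A)) (hBΛ : ∀ (Y : D₀ᵒᵖ) (b : T.BΛ.obj Y), IsUnit b)
  (DS : ∀ {A : Dᵒᵖ}, tf.Φ.carrier A → tf.Φ.carrier A → Prop) (IG : D → Prop)
  (gS : ∀ A : D, IG A → (X.Pi →* Aut A)) (gSs : ∀ (A : D) (h : IG A), Function.Surjective (gS A h))
  (NH : Subgroup (Field.absoluteGaloisGroup Kf) → tf.category → ℕ+ → Prop)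
  (AB : ∀ {A B : tf.category}, Subgroup (Aut A) → (A ⟶ A) → (A ⟶ B) → Prop) (A₀ : tf.category)
  (hA₀ : PreFrobenioid.IsFrobeniusTrivial tf.toElem A₀) (hA₀' : IG A₀.base)
  {A B : tf.category} {f : tf.biratUnitsModel A}
  {P : (mkOfModel X tf hZ hP hBΛ DS IG gS gSs NH AB A₀ hA₀ hA₀').FractionPair f B} {N : ℕ+}
  {pullFrac : ∀ {A A' : tf.category} (_ : A' ⟶ A), tf.biratUnitsModel A → tf.biratUnitsModel A'}
  {R : (mkOfModel X tf hZ hP hBΛ DS IG gS gSs NH AB A₀ hA₀ hA₀').NthRoot f P N pullFrac}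
  {hA : (mkOfModel X tf hZ hP hBΛ DS IG gS gSs NH AB A₀ hA₀ hA₀').IsGalois R.AN}
  {hB : (mkOfModel X tf hZ hP hBΛ DS IG gS gSs NH AB A₀ hA₀ hA₀').IsGalois R.BN}
  (K : (mkOfModel X tf hZ hP hBΛ DS IG gS gSs NH AB A₀ hA₀ hA₀').BiKummerRoot R hA hB)

/-- **"the difference … determines a twisted homomorphism `H_{B_N} → μ_N(B_N)`"** (Prop 4.3 (iii)): at the model,
`h ↦ u_{w(h)}` in the cyclotomic portion of `O^×(B_N^birat)` (sign: see the header). [cite: MochizukiEtTh2009, Prop 4.3(iii) p.91] -/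
def diffCocycle (hΦd : Objectwise (fun M _ => IsDivisorial M) tf.divisorMonoid)
    (h : (mkOfModel X tf hZ hP hBΛ DS IG gS gSs NH AB A₀ hA₀ hA₀').HA R.BN hB) :
    Kummer.Mu (N : ℕ) ((mkOfModel X tf hZ hP hBΛ DS IG gS gSs NH AB A₀ hA₀ hA₀').BiratCoeff R.BN) :=
  Kummer.Mu.mk (toUnits (BiratCoeff.of R.BN (K.diffUnit X tf hZ hP hBΛ DS IG gS gSs NH AB A₀ hA₀ hA₀' h))) (by
    rw [mem_rootsOfUnity, ← map_pow, ← map_pow, K.diffUnit_pow_eq_one X tf hZ hP hBΛ DS IG gS gSs NH AB A₀ hA₀ hA₀' hΦd,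
      map_one, map_one])

/-- The underlying birational unit of `diffCocycle h` is `u_{w(h)}`. [cite: MochizukiEtTh2009, Prop 4.3(iii) p.91] -/
theorem coe_val_diffCocycle (hΦd : Objectwise (fun M _ => IsDivisorial M) tf.divisorMonoid)
    (h : (mkOfModel X tf hZ hP hBΛ DS IG gS gSs NH AB A₀ hA₀ hA₀').HA R.BN hB) :
    ((K.diffCocycle X tf hZ hP hBΛ DS IG gS gSs NH AB A₀ hA₀ hA₀' hΦd h).val :
        (mkOfModel X tf hZ hP hBΛ DS IG gS gSs NH AB A₀ hA₀ hA₀').BiratCoeff R.BN) =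
      BiratCoeff.of R.BN (K.diffUnit X tf hZ hP hBΛ DS IG gS gSs NH AB A₀ hA₀ hA₀' h) :=
  rfl

/-- `g^N = f|_{B_N}` for `g = f_N|_{B_N}` — the `N`-th root of [FrdII] Def 2.1 (ii) at `B_N` is the restriction of the
`N`-th root `f_N` (`(f|_{A_N})|_{B_N} = (f_N^N)|_{B_N} = (f_N|_{B_N})^N`). [cite: MochizukiEtTh2009, Prop 4.2(iii) p.88] -/
theorem restrict_pow_eq :
    R.pair.restrict ^ (N : ℕ) =
      (mkOfModel X tf hZ hP hBΛ DS IG gS gSs NH AB A₀ hA₀ hA₀').restrictAlong R.pair.num R.pair.isPreStep_num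
        (pullFrac R.αData.α₁ f) := by
  rw [← R.pow_root]
  exact (map_pow _ R.root (N : ℕ)).symm

/-- **The Kummer cocycle of `f|_{B_N}` IS the bi-Kummer difference** ([FrdII] Def 2.1 (ii) cocycle of the root
`g = f_N|_{B_N}`, tree convention `h · g = ζ_h · g`): `ζ_h = diffCocycle h` for every `h ∈ H_{B_N}`.
[cite: MochizukiEtTh2009, Prop 4.3(iii) p.91] -/
theorem kummerCocycle_restrict_eq_diffCocycle (hΦd : Objectwise (fun M _ => IsDivisorial M) tf.divisorMonoid)
    (hf : (mkOfModel X tf hZ hP hBΛ DS IG gS gSs NH AB A₀ hA₀ hA₀').IsFixedByHA R.BN hB (R.pair.restrict ^ (N : ℕ)))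
    (h : (mkOfModel X tf hZ hP hBΛ DS IG gS gSs NH AB A₀ hA₀ hA₀').HA R.BN hB) :
    Kummer.kummerCocycle (BiratCoeff.nthRootsDifferByUnits _ R.BN N)
        ((mkOfModel X tf hZ hP hBΛ DS IG gS gSs NH AB A₀ hA₀ hA₀').HA R.BN hB)
        (f := BiratCoeff.of R.BN (R.pair.restrict ^ (N : ℕ))) (g := BiratCoeff.of R.BN R.pair.restrict) rfl
        (BiratCoeff.smul_of_eq_of_isFixedByHA hf) h =
      K.diffCocycle X tf hZ hP hBΛ DS IG gS gSs NH AB A₀ hA₀ hA₀' hΦd h := by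
  apply Kummer.kummerCocycle_eq_of_smul_eq
  rw [coe_val_diffCocycle, BiratCoeff.smul_of, ← map_mul]
  exact congrArg (BiratCoeff.of R.BN) (K.biratAut_restrict_mkOfModel X tf hZ hP hBΛ DS IG gS gSs NH AB A₀ hA₀ hA₀' h)

/-- `diffCocycle` is a `1`-cocycle of `H_{B_N}` with values in `μ_N` (it IS the Kummer cocycle).
[cite: MochizukiEtTh2009, Prop 4.3(iii) p.91] -/
theorem isMulCocycle₁_diffCocycle (hΦd : Objectwise (fun M _ => IsDivisorial M) tf.divisorMonoid)
    (hf : (mkOfModel X tf hZ hP hBΛ DS IG gS gSs NH AB A₀ hA₀ hA₀').IsFixedByHA R.BN hB (R.pair.restrict ^ (N : ℕ))) :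
    IsMulCocycle₁ (K.diffCocycle X tf hZ hP hBΛ DS IG gS gSs NH AB A₀ hA₀ hA₀' hΦd) := by
  have e : K.diffCocycle X tf hZ hP hBΛ DS IG gS gSs NH AB A₀ hA₀ hA₀' hΦd =
      Kummer.kummerCocycle (BiratCoeff.nthRootsDifferByUnits _ R.BN N)
        ((mkOfModel X tf hZ hP hBΛ DS IG gS gSs NH AB A₀ hA₀ hA₀').HA R.BN hB)
        (f := BiratCoeff.of R.BN (R.pair.restrict ^ (N : ℕ))) (g := BiratCoeff.of R.BN R.pair.restrict) rfl
        (BiratCoeff.smul_of_eq_of_isFixedByHA hf) :=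
    funext fun h => (K.kummerCocycle_restrict_eq_diffCocycle X tf hZ hP hBΛ DS IG gS gSs NH AB A₀ hA₀ hA₀' hΦd hf h).symm
  rw [e]
  exact Kummer.isMulCocycle₁_kummerCocycle _ _ _ _

/-- **[EtTh] Prop 4.3 (iii), SECOND CLAUSE, at the model instances `mkOfModel`**: the Kummer class
`κ_{f|_{B_N}} ∈ H¹(H_{B_N}, μ_N)` ([FrdII] Def 2.1 (ii); `BiKummerSetting.kummerClassOfRoot`, computed from the root
`g = f_N|_{B_N}` — any root gives the same class) EQUALS the class of the twisted homomorphism `diffCocycle`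
determined by the bi-Kummer difference. [cite: MochizukiEtTh2009, Prop 4.3(iii) p.91] -/
theorem kummerClassOfRoot_restrict_eq (hΦd : Objectwise (fun M _ => IsDivisorial M) tf.divisorMonoid)
    (hf : (mkOfModel X tf hZ hP hBΛ DS IG gS gSs NH AB A₀ hA₀ hA₀').IsFixedByHA R.BN hB (R.pair.restrict ^ (N : ℕ))) :
    (mkOfModel X tf hZ hP hBΛ DS IG gS gSs NH AB A₀ hA₀ hA₀').kummerClassOfRoot hB (N : ℕ)
        (f := R.pair.restrict ^ (N : ℕ)) (g := R.pair.restrict) rfl hf =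
      H1π _ (cocyclesOfIsMulCocycle₁ (K.isMulCocycle₁_diffCocycle X tf hZ hP hBΛ DS IG gS gSs NH AB A₀ hA₀ hA₀' hΦd hf)) := by
  rw [kummerClassOfRoot, Kummer.kummerClassOfRoot]
  congr 1
  refine cocycles₁_ext fun h => ?_
  change Additive.ofMul (Kummer.kummerCocycle _ _ _ _ h) =
    Additive.ofMul (K.diffCocycle X tf hZ hP hBΛ DS IG gS gSs NH AB A₀ hA₀ hA₀' hΦd h)
  rw [K.kummerCocycle_restrict_eq_diffCocycle X tf hZ hP hBΛ DS IG gS gSs NH AB A₀ hA₀ hA₀' hΦd hf h]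

/-- **"In particular, this cohomology class is independent of the [simultaneous and non-simultaneous]
conjugation operations discussed in (ii)"**: any two bi-Kummer `N`-th roots `K, K'` of the same `N`-th root of a
fraction-pair (in particular any two related by the conjugations (a), (b) of Prop 4.3 (ii)) have the same class —
both are `κ_{f|_{B_N}}`. [cite: MochizukiEtTh2009, Prop 4.3(iii) p.91] -/
theorem diffClass_eq_of_biKummerRoot (hΦd : Objectwise (fun M _ => IsDivisorial M) tf.divisorMonoid)
    (K' : (mkOfModel X tf hZ hP hBΛ DS IG gS gSs NH AB A₀ hA₀ hA₀').BiKummerRoot R hA hB)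
    (hf : (mkOfModel X tf hZ hP hBΛ DS IG gS gSs NH AB A₀ hA₀ hA₀').IsFixedByHA R.BN hB (R.pair.restrict ^ (N : ℕ))) :
    H1π _ (cocyclesOfIsMulCocycle₁ (K.isMulCocycle₁_diffCocycle X tf hZ hP hBΛ DS IG gS gSs NH AB A₀ hA₀ hA₀' hΦd hf)) =
      H1π _ (cocyclesOfIsMulCocycle₁ (K'.isMulCocycle₁_diffCocycle X tf hZ hP hBΛ DS IG gS gSs NH AB A₀ hA₀ hA₀' hΦd hf)) := by
  rw [← K.kummerClassOfRoot_restrict_eq X tf hZ hP hBΛ DS IG gS gSs NH AB A₀ hA₀ hA₀' hΦd hf,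
    ← K'.kummerClassOfRoot_restrict_eq X tf hZ hP hBΛ DS IG gS gSs NH AB A₀ hA₀ hA₀' hΦd hf]

end KummerClass

end BiKummerRoot

end BiKummerSetting

end Literature.AnabelianGeometry.EtaleTheta
end
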